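import Summits.NavierStokesRegularity.NavierStokesRegularity.Theses.AdaptedFrequency
import Literature.Analysis.FluidPDE.AdaptedBackwardKernel
import Literature.Analysis.FluidPDE.ClassicalSolution
import Summits.NavierStokesRegularity.NavierStokesRegularity.Theorems.AdaptedFrequencyTangentFlowTransfer
import Summits.NavierStokesRegularity.NavierStokesRegularity.Theorems.AdaptedFrequencyAdaptedFrequencyConvergesStubHullTransferZoom
import Summits.NavierStokesRegularity.NavierStokesRegularity.Theorems.AdaptedFrequencyAdaptedFrequencyConvergesStubHullTransferLimit
import HarnessLib

/-!
# Stub `stub_hullTransfer` of line `cloud-frame-effective-tsai`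
# (crux `AdaptedFrequencyConverges`, stmt-NavierStokesRegularity-10493)

All results proved. **Hull transfer** = Type-I blow-up compactness at the singular point,
carrying the adapted kernel AND the two-sided pinching `c₀ ≤ (T − t)² H(t) ≤ C₁`, along zoom
times where the adapted frequency `Λ` stays away from `2`:

1. if `Λ` has no limit at `T`, it does not tend to `2`: there are `ε > 0` and times `t_k ↑ T`
   with `|Λ(t_k) − 2| ≥ ε` (`hullTransfer_exists_seq`);
2. zoom about `(T, x₀)` with scales `c_k = √(ν(T − t_k)) → 0` after viscosity normalisation
   (`hullTransfer_zoomData`, part I): unit-viscosity classical Type-I Oseen-mild fields on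
   windows `[A_k, 0)`, `A_k → −∞`, adapted kernels with fixed Gaussian constants, frequencies
   `Λ_k(−1) = Λ(t_k)`, pinching `c₀ ≤ (−τ)² H_k(τ) ≤ C₁` eventually in `k` for each `τ < 0`;
3. `C²_loc` compactness (`exists_tendsto_of_typeI_oseenMild_windows`), kernel stability
   (`kernelStability`, `isAdaptedBackwardKernel_of_limit`), one pressure
   (`exists_isClassicalNSSolutionOn_Iio_of_isTypeIAncientMild`);
4. passage to the limit (`hullTransfer_tendsto_enstrophy_frequency`, part II): the limit pair
   `(W, K)` is PINCHED (so `H̄ > 0` for free — no non-degeneracy hypothesis) and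
   `Λ̄(−1) = lim Λ(t_k)`, whence `|Λ̄(−1) − 2| ≥ ε`;
5. if `h̄ = (−τ)² H̄` were constant, `H̄(τ) = κ/τ²` and `Λ̄(−1) = 2`
   (`hullTransfer_frequency_two_of_const`): so `h̄` takes two different values;
6. time dilation back to viscosity `ν` (`AdaptedFrequencyTangentFlowTransferDilation`), which
   preserves pinching (same constants) and non-constancy of `h̄`.
-/

noncomputable section

namespace Summit.NavierStokesRegularity.NavierStokesRegularity.Theorems.AdaptedFrequencyConverges.CloudFrameEffectiveTsai

open scoped Topology
open Literature.Analysis Literature.Analysis.FluidPDE Set Filter MeasureTheory Function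

/-- **Step 1: non-convergence gives a sequence along which the frequency stays away from `2`.**
If `Λ` has no limit as `t ↑ T`, then in particular `Λ ↛ 2`, so there are `ε > 0` and times
`t_k < T`, `t_k → T`, with `ε ≤ |Λ(t_k) − 2|`. [folklore] -/
theorem hullTransfer_exists_seq {Λ : ℝ → ℝ} {T : ℝ}
    (h : ¬ ∃ Λ₀ : ℝ, Tendsto Λ (𝓝[<] T) (𝓝 Λ₀)) :
    ∃ (ε : ℝ) (t : ℕ → ℝ), 0 < ε ∧ (∀ k, t k < T) ∧ Tendsto t atTop (𝓝 T) ∧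
      ∀ k, ε ≤ |Λ (t k) - 2| := by
  have h2 : ¬ Tendsto Λ (𝓝[<] T) (𝓝 2) := fun h' => h ⟨2, h'⟩
  obtain ⟨s, hs, hfr⟩ := not_tendsto_iff_exists_frequently_notMem.1 h2
  obtain ⟨ε, hε, hball⟩ := Metric.mem_nhds_iff.1 hs
  have hfr' : ∃ᶠ x in 𝓝[<] T, ε ≤ |Λ x - 2| ∧ x < T := by
    refine (hfr.mono fun x hx => ?_).and_eventually eventually_mem_nhdsWithin
    by_contra hlt
    push Not at hlt
    exact hx (hball (by rw [Metric.mem_ball, Real.dist_eq]; exact hlt))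
  obtain ⟨t, ht, hP⟩ := exists_seq_forall_of_frequently hfr'
  exact ⟨ε, t, hε, fun k => (hP k).2, tendsto_nhds_of_tendsto_nhdsWithin ht, fun k => (hP k).1⟩

/-- **Step 5: a constant `h̄ = (−τ)² H̄` forces frequency `2`.** If `(−τ₁)² H τ₁ = (−τ₂)² H τ₂`
for all negative `τ₁, τ₂` and `H(−1) ≠ 0`, then `H τ = H(−1)/τ²` near `−1` and the adapted
frequency about pole time `0` at `τ = −1` is `(0 − (−1)) H′(−1)/H(−1) = 2`. [folklore] -/
theorem hullTransfer_frequency_two_of_const (H : ℝ → ℝ) (hH : H (-1) ≠ 0)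
    (hall : ∀ τ₁ τ₂ : ℝ, τ₁ < 0 → τ₂ < 0 → (-τ₁) ^ 2 * H τ₁ = (-τ₂) ^ 2 * H τ₂) :
    (0 - (-1)) * deriv H (-1) / H (-1) = 2 := by
  have hHτ : ∀ τ < 0, H τ = H (-1) / τ ^ 2 := by
    intro τ hτ
    have h := hall τ (-1) hτ (by norm_num)
    have hτ2 : τ ^ 2 ≠ 0 := pow_ne_zero 2 hτ.ne
    rw [neg_neg, one_pow, one_mul] at h
    rw [← h, eq_div_iff hτ2]
    ring
  have hev : H =ᶠ[𝓝 (-1)] fun τ => H (-1) / τ ^ 2 := by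
    filter_upwards [Iio_mem_nhds (show (-1:ℝ) < 0 by norm_num)] with τ hτ using hHτ τ hτ
  have hd : HasDerivAt (fun τ : ℝ => H (-1) / τ ^ 2) (2 * H (-1)) (-1) := by
    have h1 := ((hasDerivAt_const (-1:ℝ) (H (-1))).fun_div (hasDerivAt_pow 2 (-1:ℝ))
      (by norm_num))
    refine h1.congr_deriv ?_
    norm_num
    ring
  rw [hev.deriv_eq, hd.deriv]
  field_simp
  norm_num

/-- **Steps 2–5 at unit viscosity: the pinched tangent pair with non-constant `h̄`.** Under the
hypotheses of the stub (Type-I classical Leray–Hopf solution, adapted comparable kernel on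
`[t₀, T)`, two-sided pinching on `[t₁, T)`, no limit of the adapted frequency), there are a
constant `C₀ ≥ 0`, a classical unit-viscosity solution `(W, q)` on `(−∞, 0)` with
`‖W‖ ≤ C₀/√(−t)`, and an adapted kernel `K` of `W` on `(−∞, 0)` with pole `(0, 0)` under
two-sided Gaussian bounds, such that `c₀ ≤ (−τ)² H̄(τ) ≤ C₁` for all `τ < 0` and
`(−τ)² H̄(τ)` takes two different values. [folklore] -/
theorem hullTransfer_unit {ν T : ℝ} (hν : 0 < ν) (hT : 0 < T)
    {u : ℝ → EuclideanSpace ℝ (Fin 3) → EuclideanSpace ℝ (Fin 3)}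
    {p : ℝ → EuclideanSpace ℝ (Fin 3) → ℝ} (hcl : IsClassicalNSSolutionOn (Ico 0 T) ν 0 u p)
    (hLH : IsLerayHopfOn T ν 0 (u 0) u) (hTI : IsTypeIBlowup u T)
    {x₀ : EuclideanSpace ℝ (Fin 3)} {t₀ : ℝ} (ht₀ : t₀ ∈ Ico 0 T)
    {G : ℝ → EuclideanSpace ℝ (Fin 3) → ℝ} (hK : IsAdaptedBackwardKernel ν u (Ico t₀ T) T x₀ G)
    {a₁ a₂ A₁ A₂ : ℝ} (ha₁ : 0 < a₁) (ha₂ : 0 < a₂) (hA₁ : 0 < A₁) (hA₂ : 0 < A₂)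
    (hGb : ∀ t ∈ Ico t₀ T, ∀ x,
      a₁ * (T - t) ^ (-(3:ℝ) / 2) * Real.exp (-(‖x - x₀‖ ^ 2) / (a₂ * (T - t))) ≤ G t x ∧
        G t x ≤ A₁ * (T - t) ^ (-(3:ℝ) / 2) * Real.exp (-(‖x - x₀‖ ^ 2) / (A₂ * (T - t))))
    {t₁ c₀ C₁ : ℝ} (ht₁ : t₁ ∈ Ico t₀ T) (hc₀ : 0 < c₀)
    (hpinch : ∀ t ∈ Ico t₁ T, c₀ ≤ (T - t) ^ 2 * adaptedEnstrophy u G t ∧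
      (T - t) ^ 2 * adaptedEnstrophy u G t ≤ C₁)
    (hnot : ¬ ∃ Λ₀ : ℝ, Tendsto (adaptedFrequency u G T) (𝓝[<] T) (𝓝 Λ₀)) :
    ∃ (C₀ : ℝ) (W : ℝ → EuclideanSpace ℝ (Fin 3) → EuclideanSpace ℝ (Fin 3))
      (q : ℝ → EuclideanSpace ℝ (Fin 3) → ℝ) (K : ℝ → EuclideanSpace ℝ (Fin 3) → ℝ),
      IsClassicalNSSolutionOn (Iio 0) 1 0 W q ∧
      (∀ t ∈ Iio (0:ℝ), ∀ x, ‖W t x‖ ≤ C₀ / Real.sqrt (-t)) ∧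
      IsAdaptedBackwardKernel 1 W (Iio 0) 0 0 K ∧
      (∀ t ∈ Iio (0:ℝ), ∀ x,
        (a₁ * ν ^ ((3:ℝ) / 2)) * ((0:ℝ) - t) ^ (-(3:ℝ) / 2) *
            Real.exp (-(‖x - (0 : EuclideanSpace ℝ (Fin 3))‖ ^ 2) / ((a₂ / ν) * ((0:ℝ) - t))) ≤
          K t x ∧
        K t x ≤ (A₁ * ν ^ ((3:ℝ) / 2)) * ((0:ℝ) - t) ^ (-(3:ℝ) / 2) *
            Real.exp (-(‖x - (0 : EuclideanSpace ℝ (Fin 3))‖ ^ 2) / ((A₂ / ν) * ((0:ℝ) - t)))) ∧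
      (∀ τ ∈ Iio (0:ℝ), c₀ ≤ (-τ) ^ 2 * adaptedEnstrophy W K τ ∧
        (-τ) ^ 2 * adaptedEnstrophy W K τ ≤ C₁) ∧
      ∃ τ₁ τ₂ : ℝ, τ₁ < 0 ∧ τ₂ < 0 ∧
        (-τ₁) ^ 2 * adaptedEnstrophy W K τ₁ ≠ (-τ₂) ^ 2 * adaptedEnstrophy W K τ₂ := by
  -- a Type-I window
  obtain ⟨Cu, tu, htuT, hI⟩ := exists_window_of_isTypeIBlowup hTI
  -- Step 1: times where `Λ` stays away from `2`
  obtain ⟨ε, tk, hε, htkT, htk, hΛε⟩ := hullTransfer_exists_seq hnot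
  -- the scales `c_k = √(ν (T − t_k)) → 0`
  set c : ℕ → ℝ := fun k => Real.sqrt (ν * (T - tk k)) with hcdef
  have hpos : ∀ k, 0 < ν * (T - tk k) := fun k => mul_pos hν (by linarith [htkT k])
  have hc : ∀ k, 0 < c k := fun k => Real.sqrt_pos.2 (hpos k)
  have hc2 : ∀ k, c k ^ 2 = ν * (T - tk k) := fun k => Real.sq_sqrt (hpos k).le
  have hc0 : Tendsto c atTop (𝓝 0) := by
    have h1 : Tendsto (fun k => ν * (T - tk k)) atTop (𝓝 (ν * (T - T))) :=
      tendsto_const_nhds.mul (tendsto_const_nhds.sub htk)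
    rw [sub_self, mul_zero] at h1
    have h2 := h1.sqrt
    rw [Real.sqrt_zero] at h2
    exact h2
  have hzoom1 : ∀ k, T + c k ^ 2 * (-1) / ν = tk k := by
    intro k
    rw [hc2]
    field_simp
    ring
  -- Step 2: the zoomed, viscosity-normalised data
  obtain ⟨C₀, A, w, pw, g, hC₀, hA, -, hclw, hIw, hmildw, hgw, hgb, hfreq, hpin⟩ :=
    hullTransfer_zoomData hν hT hcl hLH htuT hI ht₀ hK hGb hpinch hc hc0
  -- Step 3a: `C²_loc` extraction
  have hcont : ∀ k, ContinuousOn (uncurry (w k)) (Ioo (A k) 0 ×ˢ univ) := fun k =>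
    (hclw k).smooth_velocity.continuousOn.mono (prod_mono Ioo_subset_Ico_self Subset.rfl)
  have hwdf : ∀ k, ∀ t ∈ Ioo (A k) 0, IsWeaklyDivFree (w k t) := fun k t ht =>
    VectorCalculus.IsDivFree.isWeaklyDivFree_holds ((hclw k).divFree t (Ioo_subset_Ico_self ht))
      (contDiff_infty.1 ((hclw k).contDiff_velocity (Ioo_subset_Ico_self ht)) 1)
  obtain ⟨φ, hφ, W, hW, hW0, hW1, hW2⟩ :=
    exists_tendsto_of_typeI_oseenMild_windows hC₀ hA hcont hwdf hmildw hIw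
  -- Step 3b: kernel stability along the subsequence
  have hφt : Tendsto φ atTop atTop := hφ.tendsto_atTop
  have ha₁' : 0 < a₁ * ν ^ ((3:ℝ) / 2) := mul_pos ha₁ (Real.rpow_pos_of_pos hν _)
  have hA₁' : 0 < A₁ * ν ^ ((3:ℝ) / 2) := mul_pos hA₁ (Real.rpow_pos_of_pos hν _)
  have ha₂' : 0 < a₂ / ν := div_pos ha₂ hν
  have hA₂' : 0 < A₂ / ν := div_pos hA₂ hν
  obtain ⟨ψ, hψ, K, hKc, hKeq, hgK⟩ := kernelStability C₀ (a₁ * ν ^ ((3:ℝ) / 2)) (a₂ / ν)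
    (A₁ * ν ^ ((3:ℝ) / 2)) (A₂ / ν) (A ∘ φ) (fun k => w (φ k)) (fun k => pw (φ k))
    (fun k => g (φ k)) W hC₀ ha₁' ha₂' hA₁' hA₂' (hA.comp hφt) (fun k => hclw (φ k))
    (fun k => hIw (φ k)) (fun k => hmildw (φ k)) (fun k => hgw (φ k)) (fun k => hgb (φ k))
    hW hW0 hW1 hW2
  have hψt : Tendsto ψ atTop atTop := hψ.tendsto_atTop
  have hφψt : Tendsto (fun j => φ (ψ j)) atTop atTop := hφt.comp hψt
  obtain ⟨hKW, hKb⟩ := isAdaptedBackwardKernel_of_limit (g := fun j => g (φ (ψ j)))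
    (A := fun j => A (φ (ψ j))) (hA.comp hφψt) (fun j => (hgw _).integral_eq_one)
    (fun j t ht => ((hgw _).contDiff_slice ht).continuous) ha₁' hA₂'
    (fun j => hgb (φ (ψ j))) hKc hKeq hgK
  -- Step 3c: one pressure for the tangent flow
  obtain ⟨q, hWcl⟩ := exists_isClassicalNSSolutionOn_Iio_of_isTypeIAncientMild hW
  -- Step 4a: limits of `H_k(τ)` and `Λ_k(τ)` along `j ↦ φ (ψ j)`
  have hlim := fun (τ : ℝ) (hτ : τ < 0) =>
    hullTransfer_tendsto_enstrophy_frequency hC₀ (hA.comp hφψt) (fun k => hclw (φ (ψ k)))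
      (fun k => hmildw (φ (ψ k))) (fun k => hIw (φ (ψ k))) (fun k => hgw (φ (ψ k))) hA₁'.le hA₂'
      (fun k t ht x => (hgb (φ (ψ k)) t ht x).2) hWcl hKW
      (fun t ht x => (tendsto_at_of_tendstoLocallyUniformly (hW1 t ht) x).comp hψt)
      (fun t ht x => (tendsto_at_of_tendstoLocallyUniformly (hW2 t ht) x).comp hψt) hgK hτ
  -- Step 4b: the limit pair is pinched
  have hpinW : ∀ τ < 0, c₀ ≤ (-τ) ^ 2 * adaptedEnstrophy W K τ ∧
      (-τ) ^ 2 * adaptedEnstrophy W K τ ≤ C₁ := by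
    intro τ hτ
    have hH := ((hlim τ hτ).1).const_mul ((-τ) ^ 2)
    have hev : ∀ᶠ j in atTop, t₁ ≤ T + c (φ (ψ j)) ^ 2 * τ / ν := by
      have h1 : Tendsto (fun j => T + c (φ (ψ j)) ^ 2 * τ / ν) atTop
          (𝓝 (T + 0 ^ 2 * τ / ν)) :=
        tendsto_const_nhds.add ((((hc0.comp hφψt).pow 2).mul_const τ).div_const ν)
      rw [zero_pow two_ne_zero, zero_mul, zero_div, add_zero] at h1
      exact (h1.eventually (eventually_gt_nhds ht₁.2)).mono fun j hj => hj.le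
    exact ⟨ge_of_tendsto hH (hev.mono fun j hj => (hpin _ τ hτ hj).1),
      le_of_tendsto hH (hev.mono fun j hj => (hpin _ τ hτ hj).2)⟩
  have hposW : ∀ τ < 0, 0 < adaptedEnstrophy W K τ := by
    intro τ hτ
    have h1 := (hpinW τ hτ).1
    have h2 : 0 < (-τ) ^ 2 := pow_pos (neg_pos.2 hτ) 2
    exact pos_of_mul_pos_right (hc₀.trans_le h1) h2.le
  -- Step 4c: the frequency of the limit at `τ = -1` is a limit of `Λ(t_k)`, hence `≠ 2`
  have hΛ1 : Tendsto (fun j => adaptedFrequency (w (φ (ψ j))) (g (φ (ψ j))) 0 (-1)) atTop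
      (𝓝 (adaptedFrequency W K 0 (-1))) :=
    (hlim (-1) (by norm_num)).2 (hposW (-1) (by norm_num)).ne'
  have hΛ1' : ∀ j, adaptedFrequency (w (φ (ψ j))) (g (φ (ψ j))) 0 (-1) =
      adaptedFrequency u G T (tk (φ (ψ j))) := by
    intro j
    rw [hfreq, hzoom1]
  have hfar : ε ≤ |adaptedFrequency W K 0 (-1) - 2| := by
    have hc' := (continuous_abs.tendsto _).comp (hΛ1.sub_const 2)
    refine ge_of_tendsto hc' (Eventually.of_forall fun j => ?_)
    simp only [Function.comp]
    rw [hΛ1']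
    exact hΛε _
  have hne2 : adaptedFrequency W K 0 (-1) ≠ 2 := by
    intro h
    rw [h, sub_self, abs_zero] at hfar
    linarith
  -- Step 5: `h̄` is not constant
  have hnc : ∃ τ₁ τ₂ : ℝ, τ₁ < 0 ∧ τ₂ < 0 ∧
      (-τ₁) ^ 2 * adaptedEnstrophy W K τ₁ ≠ (-τ₂) ^ 2 * adaptedEnstrophy W K τ₂ := by
    by_contra hall
    push Not at hall
    apply hne2
    rw [adaptedFrequency_apply]
    exact hullTransfer_frequency_two_of_const (adaptedEnstrophy W K)
      (hposW (-1) (by norm_num)).ne' hall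
  exact ⟨C₀, W, q, K, hWcl, fun t ht x => hW.norm_le ht x, hKW, hKb, fun τ hτ => hpinW τ hτ, hnc⟩

/-- **Hull transfer** (Type-I blow-up compactness at the singular point, carrying the kernel; the
converse direction of `TangentFlowTransfer`): under the crux hypotheses and two-sided pinching of
`(T−t)²H` on a final window, if the adapted frequency has NO limit at `T`, then some Type-I zoom
at `(T, x₀)` along times where `Λ` stays away from `2` converges to an ETERNAL TYPE-I PAIR: a
classical solution `(v, q)` of NS on `ℝ³ × (−∞,0)` with `‖v(t,x)‖ ≤ C/√(−t)`, an adapted kernel `K`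
of `v` on `(−∞,0)` with pole `(0,0)`, two-sided Gaussian-comparable, whose rescaled adapted
enstrophy `h̄(τ) = (−τ)²·∫‖curl v(τ)‖²K(τ)` is pinched between positive constants on `(−∞,0)`
and is NOT constant (steps 1–6 of the module docstring). [folklore] -/
theorem stub_hullTransfer :
    ∀ (ν T : ℝ) (u : ℝ → (EuclideanSpace ℝ (Fin 3)) → (EuclideanSpace ℝ (Fin 3))) (p : ℝ → (EuclideanSpace ℝ (Fin 3)) → ℝ) (x₀ : (EuclideanSpace ℝ (Fin 3))) (t₀ : ℝ) (G : ℝ → (EuclideanSpace ℝ (Fin 3)) → ℝ), 0 < ν → 0 < T → IsClassicalNSSolutionOn (Ico 0 T) ν 0 u p → IsLerayHopfOn T ν 0 (u 0) u → HasRapidSpatialDecay (u 0) → IsTypeIBlowup u T → t₀ ∈ Ico 0 T → (∀ r : ℝ, 0 < r → eLpNorm (Function.uncurry u) ⊤ (volume.restrict (parabolicCylinder r (T, x₀))) = ⊤) → IsAdaptedBackwardKernel ν u (Ico t₀ T) T x₀ G → IsGaussianComparable G (Ico t₀ T) T x₀ → ∀ (t₁ c₀ C₁ : ℝ), t₁ ∈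 Ico t₀ T → 0 < c₀ → (∀ t ∈ Ico t₁ T, c₀ ≤ (T - t) ^ 2 * adaptedEnstrophy u G t ∧ (T - t) ^ 2 * adaptedEnstrophy u G t ≤ C₁) → (¬ ∃ Λ₀ : ℝ, Tendsto (adaptedFrequency u G T) (𝓝[<] T) (𝓝 Λ₀)) → ∃ (C c' C' : ℝ) (v : ℝ → (EuclideanSpace ℝ (Fin 3)) → (EuclideanSpace ℝ (Fin 3))) (q : ℝ → (EuclideanSpace ℝ (Fin 3)) → ℝ) (K : ℝ → (EuclideanSpace ℝ (Fin 3)) → ℝ), 0 < c' ∧ IsClassicalNSSolutionOn (Iio 0) ν 0 v q ∧ (∀ t ∈ Iio (0:ℝ), ∀ x, ‖v t x‖ ≤ C / Real.sqrt (-t)) ∧ IsAdaptedBackwardKernel ν v (Iio 0) 0 0 K ∧ IsGaussianComparable K (Iio 0) 0 0 ∧ (∀ τ ∈ Iio (0:ℝ), c' ≤ (-τ) ^ 2 * adaptedEnstrophy v K τ ∧ (-τ) ^ 2 * adaptedEnstrophy v K τ ≤ C') ∧ ∃ τ₁ τ₂ : ℝ, τ₁ < 0 ∧ τ₂ < 0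 ∧ (-τ₁) ^ 2 * adaptedEnstrophy v K τ₁ ≠ (-τ₂) ^ 2 * adaptedEnstrophy v K τ₂ := by
  intro ν T u p x₀ t₀ G hν hT hcl hLH _hdec hTI ht₀ _hsing hK hGc t₁ c₀ C₁ ht₁ hc₀ hpinch hnot
  -- the Gaussian constants of `G`
  obtain ⟨a₁, a₂, A₁, A₂, ha₁, ha₂, hA₁, hA₂, hGb⟩ := isGaussianComparable_iff_fin_three.1 hGc
  -- Steps 1–5 at unit viscosity
  obtain ⟨C₀, W, q, K, hWcl, hWI, hKW, hKb, hpinW, τ₁, τ₂, hτ₁, hτ₂, hneq⟩ :=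
    hullTransfer_unit hν hT hcl hLH hTI ht₀ hK ha₁ ha₂ hA₁ hA₂ hGb ht₁ hc₀ hpinch hnot
  -- Step 6: back to viscosity `ν`
  have ha₁' : 0 < a₁ * ν ^ ((3:ℝ) / 2) := mul_pos ha₁ (Real.rpow_pos_of_pos hν _)
  have hA₁' : 0 < A₁ * ν ^ ((3:ℝ) / 2) := mul_pos hA₁ (Real.rpow_pos_of_pos hν _)
  have ha₂' : 0 < a₂ / ν := div_pos ha₂ hν
  have hA₂' : 0 < A₂ / ν := div_pos hA₂ hν
  have h3 : Module.finrank ℝ (EuclideanSpace ℝ (Fin 3)) = 3 := finrank_euclideanSpace_fin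
  have h3' : ((Module.finrank ℝ (EuclideanSpace ℝ (Fin 3)) : ℕ) : ℝ) = 3 := by
    rw [h3]; norm_num
  have hvcl := isClassicalNSSolutionOn_dilate_Iio hWcl hν
  rw [mul_one] at hvcl
  have hKν := isAdaptedBackwardKernel_dilate_Iio hKW hν
  rw [mul_one] at hKν
  have hKνb := gaussian_bounds_dilate_Iio (E := EuclideanSpace ℝ (Fin 3)) (G := K)
    (x₀ := (0 : EuclideanSpace ℝ (Fin 3)))
    (c₁ := a₁ * ν ^ ((3:ℝ) / 2)) (c₂ := a₂ / ν) (C₁ := A₁ * ν ^ ((3:ℝ) / 2)) (C₂ := A₂ / ν) hν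
    (by rw [h3']; exact hKb)
  rw [h3'] at hKνb
  refine ⟨C₀ * Real.sqrt ν, c₀, C₁, ν • stPull ν 1 0 0 W, ν ^ 2 • stPull ν 1 0 0 q,
    stPull ν 1 0 0 K, hc₀, hvcl, typeI_bound_dilate hWI hν, hKν, ?_, ?_,
    τ₁ / ν, τ₂ / ν, div_neg_of_neg_of_pos hτ₁ hν, div_neg_of_neg_of_pos hτ₂ hν, ?_⟩
  · -- Gaussian comparability of the dilated kernel
    exact isGaussianComparable_iff_fin_three.2
      ⟨a₁ * ν ^ ((3:ℝ) / 2) * ν ^ (-(3:ℝ) / 2), a₂ / ν * ν,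
        A₁ * ν ^ ((3:ℝ) / 2) * ν ^ (-(3:ℝ) / 2), A₂ / ν * ν,
        mul_pos ha₁' (Real.rpow_pos_of_pos hν _), mul_pos ha₂' hν,
        mul_pos hA₁' (Real.rpow_pos_of_pos hν _), mul_pos hA₂' hν, hKνb⟩
  · -- pinching is dilation invariant
    intro s hs
    have hs0 : s < 0 := hs
    have hs' : 0 + ν * s < 0 := by
      have : ν * s < 0 := mul_neg_of_pos_of_neg hν hs0
      linarith
    have h := hpinW (0 + ν * s) hs'
    have e : (-s) ^ 2 * adaptedEnstrophy (ν • stPull ν 1 0 0 W) (stPull ν 1 0 0 K) s =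
        (-(0 + ν * s)) ^ 2 * adaptedEnstrophy W K (0 + ν * s) := by
      rw [adaptedEnstrophy_dilate]
      ring
    rw [e]
    exact h
  · -- non-constancy is dilation invariant
    have e : ∀ τ : ℝ, (-(τ / ν)) ^ 2 *
        adaptedEnstrophy (ν • stPull ν 1 0 0 W) (stPull ν 1 0 0 K) (τ / ν) =
        (-τ) ^ 2 * adaptedEnstrophy W K τ := by
      intro τ
      rw [adaptedEnstrophy_dilate]
      have e1 : 0 + ν * (τ / ν) = τ := by
        rw [zero_add]
        field_simp
      rw [e1]
      field_simp
    rw [e, e]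
    exact hneq

end Summit.NavierStokesRegularity.NavierStokesRegularity.Theorems.AdaptedFrequencyConverges.CloudFrameEffectiveTsai

end
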